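import Mathlib.Algebra.MvPolynomial.PDeriv
import Mathlib.Algebra.Order.Antidiag.Finsupp
import Mathlib.Data.Finsupp.Weight
import Literature.AlgebraicGeometry.Resolution.OrdZeroBasics
import HarnessLib
import HarnessLib.Audit.Tags

/-!
# Purely inseparable four-folds — the TSCHIRNHAUS SOLVE, one step: second-order Taylor along one letter
# and the degree-by-degree correction (cell `res-dim4-pi`, K2(p) lane, brick (ii) FILE D, part 1)

[OURS · counted 0 · cell `res-dim4-pi` · brick (ii) «Tschirnhaus / W-frame infrastructure», FILE D, desk
WORDS #81/#83, seat res-dim4-p-1 g3.]  Nothing here proves K2(p), `NoIsolatedTrap p p` or resolution of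
singularities in dimension ≥ 4 / characteristic `p`.  AI kernel work, weaker than expert review.

The W-frame of idea-4's CARD I-4-7 (TS) / memo E2-WINDOW (A2) re-coordinatises a residual polynomial
`G ∈ K[x₁, …, x₄]` whose degree-`d` initial form is the `d`-th power `c·x_f^d` of ONE free (contact)
letter `x_f`, `d < p`, by the move `x_f ↦ x_f + φ(u)` (`u` = the three other letters, `φ(0) = 0`;
FILE B's `FrameChange.tsch f φ`) so as to kill the `x_f^{d-1}`-coefficient of `G` («completing the
`d`-th power», the classical Tschirnhaus transformation; it needs `d` to be a unit of `K`).  The cards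
read finitely many coefficients only, so the tree wants the JET-LEVEL statement (part 2,
`…TschirnhausJet`: for every `N` a polynomial `φ_N` killing the `x_f^{d-1}·u^m`-coefficients with
`|m| ≤ N`, unique to that order).  This part 1 is the engine of the degree-by-degree solve, pure
polynomial algebra over every field:

* §1 `exists_taylor_two` — `τ H = H + δ·∂_f H + δ²·R` for every `K`-algebra endomorphism `τ` of
  `K[x₁..x₄]` with `τ x_f = x_f + δ`, `τ x_i = x_i` (`i ≠ f`).
* §2 bookkeeping: a factor all of whose monomials are `x_f`-free of degree `≥ k` does not touch the
  coefficients of `x_f^j·u^m`, `|m| < k` (`coeff_add_single_mul_eq_zero`), and touches `|m| ≤ k` only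
  through its own `u^m`-coefficient (`coeff_add_single_mul_of_degree_le`); the pure powers `x_f^j` keep
  their coefficients under the move (`coeff_single_frameChange`); the monomials `u^m`, `|m| = n`, are
  `(univ.erase f).finsuppAntidiag n` (`mem_finsuppAntidiag_erase_iff`).
* §3 **`jet_step`**: if the `x_f^{d-1}·u^m`-coefficients of `G(x_f + φ, u)` vanish for `|m| ≤ N`, the
  explicit degree-`(N+1)` correction `δ = −(d·c)⁻¹ Σ_{|m|=N+1} coeff_{x_f^{d-1}u^m}(G(x_f + φ, u))·u^m`
  makes them vanish for `|m| ≤ N + 1` (the new error is `δ·∂_f(…) + O(δ²)` and `∂_f` contributes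
  `d·c·δ` in `u`-degree `N + 1`).

Statements quantify over EVERY endomorphism `τ` with the two values (`τ x_f = x_f + φ`, `τ x_i = x_i`),
so they apply verbatim to FILE B's `FrameChange.tsch f φ` by `tsch_X_self` / `tsch_X_of_ne`.
Sources: [cite: Abhyankar1990, Lecture 22 p.174 (Shreedharacharya's «completing the d-th power»
`X_n → X_n + f̂₁/d`, `d` prime to the characteristic) and p.186 («it suffices to compute `f̂₁` only up
to a certain order»)]; [cite: CossartPiltant2009, I.8.3.6]; [cite: Kollar2007, 1.89 and Aside 3.57];
[cite: Hauser2014Obergurgl, Def. 9.3–Prop. 9.5].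
bears_on: LADDER-RESOLUTION:D157-DOOR2 (res-dim4-pi · K2(p) · brick (ii) FILE D).  Supports
stmt-ResolutionOfSingularities-16155 (helper).
-/

set_option linter.dupNamespace false -- mandated namespace of this single-conjunct summit

noncomputable section

namespace Summit.ResolutionOfSingularities.ResolutionOfSingularities.Theorems.PIDim4

namespace FrameChange

open MvPolynomial Finset
open Literature.AlgebraicGeometry.Resolution.Hauser2010

variable {K : Type} [Field K]

/-! ## 1. Taylor expansion to second order along one letter -/

/-- **Second-order Taylor expansion along `x_f`.**  For a `K`-algebra endomorphism `τ` of `K[x₁..x₄]`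
with `τ x_f = x_f + δ` and `τ x_i = x_i` (`i ≠ f`): `τ H = H + δ·∂H/∂x_f + δ²·R` for some `R`.
[cite: Abhyankar1990, Lecture 22 p.174 (substitution `X_n → X_n + h`)] [folklore] -/
theorem exists_taylor_two (τ : MvPolynomial (Fin 4) K →ₐ[K] MvPolynomial (Fin 4) K) (f : Fin 4)
    (δ : MvPolynomial (Fin 4) K) (hf : τ (X f) = X f + δ) (hi : ∀ i, i ≠ f → τ (X i) = X i)
    (H : MvPolynomial (Fin 4) K) :
    ∃ R : MvPolynomial (Fin 4) K, τ H = H + δ * pderiv f H + δ ^ 2 * R := by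
  induction H using MvPolynomial.induction_on with
  | C a => exact ⟨0, by simp⟩
  | add p q hp hq =>
    obtain ⟨R₁, h₁⟩ := hp
    obtain ⟨R₂, h₂⟩ := hq
    exact ⟨R₁ + R₂, by rw [map_add, h₁, h₂, map_add]; ring⟩
  | mul_X p i hp =>
    obtain ⟨R₁, h₁⟩ := hp
    by_cases hif : i = f
    · refine ⟨pderiv f p + R₁ * (X f + δ), ?_⟩
      rw [hif, map_mul, h₁, hf, pderiv_mul, pderiv_X_self]
      ring
    · refine ⟨R₁ * X i, ?_⟩
      rw [map_mul, h₁, hi i hif, pderiv_mul, pderiv_X_of_ne hif]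
      ring

/-! ## 2. Coefficient bookkeeping for `x_f`-free factors -/

/-- If `a + b = m + j·e_f` and `a_f = 0` then `a ≤ m`. [folklore] -/
theorem le_of_add_eq_add_single {f : Fin 4} {a b m : Fin 4 →₀ ℕ} {j : ℕ}
    (h : a + b = m + Finsupp.single f j) (ha : a f = 0) : a ≤ m := by
  rw [Finsupp.le_def]
  intro i
  by_cases hi : i = f
  · rw [hi, ha]
    exact Nat.zero_le _
  · have := DFunLike.congr_fun h i
    simp only [Finsupp.add_apply, Finsupp.single_apply, if_neg (Ne.symm hi), add_zero] at this
    omega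

/-- `a ≤ m` with `|m| ≤ |a|` forces `a = m`. [folklore] -/
theorem eq_of_le_of_degree_le {a m : Fin 4 →₀ ℕ} (h : a ≤ m) (hd : m.degree ≤ a.degree) :
    a = m := by
  have hm : a + (m - a) = m := add_tsub_cancel_of_le h
  have hdeg := congrArg Finsupp.degree hm
  rw [map_add] at hdeg
  have hc : (m - a).degree = 0 := by omega
  rwa [(Finsupp.degree_eq_zero_iff _).mp hc, add_zero] at hm

/-- A factor whose monomials are `x_f`-free of degree `≥ k` does not touch the coefficients of
`x_f^j · u^m` with `|m| < k`. [folklore] -/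
theorem coeff_add_single_mul_eq_zero {f : Fin 4} {δ : MvPolynomial (Fin 4) K} {k : ℕ}
    (hδ : ∀ a ∈ δ.support, a f = 0 ∧ k ≤ a.degree) (P : MvPolynomial (Fin 4) K)
    {m : Fin 4 →₀ ℕ} (hm : m.degree < k) (j : ℕ) :
    coeff (m + Finsupp.single f j) (δ * P) = 0 := by
  rw [coeff_mul]
  refine Finset.sum_eq_zero fun x hx => ?_
  rw [Finset.mem_antidiagonal] at hx
  by_cases hxs : x.1 ∈ δ.support
  · obtain ⟨hxf, hxk⟩ := hδ x.1 hxs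
    have hle : x.1.degree ≤ m.degree := Finsupp.degree_mono (le_of_add_eq_add_single hx hxf)
    exact (lt_irrefl k (hxk.trans_lt (hle.trans_lt hm))).elim
  · rw [notMem_support_iff.mp hxs, zero_mul]

/-- A factor whose monomials are `x_f`-free of degree `≥ k` touches the coefficient of `x_f^j · u^m`,
`|m| ≤ k`, only through its own `u^m`-coefficient times the `x_f^j`-coefficient of the cofactor.
[folklore] -/
theorem coeff_add_single_mul_of_degree_le {f : Fin 4} {δ : MvPolynomial (Fin 4) K} {k : ℕ}
    (hδ : ∀ a ∈ δ.support, a f = 0 ∧ k ≤ a.degree) (P : MvPolynomial (Fin 4) K)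
    {m : Fin 4 →₀ ℕ} (hm : m.degree ≤ k) (j : ℕ) :
    coeff (m + Finsupp.single f j) (δ * P) = coeff m δ * coeff (Finsupp.single f j) P := by
  rw [coeff_mul]
  refine Finset.sum_eq_single (m, Finsupp.single f j) (fun x hx hne => ?_) (fun h => ?_)
  · rw [Finset.mem_antidiagonal] at hx
    by_cases hxs : x.1 ∈ δ.support
    · obtain ⟨hxf, hxk⟩ := hδ x.1 hxs
      have h1 : x.1 = m := eq_of_le_of_degree_le (le_of_add_eq_add_single hx hxf) (hm.trans hxk)
      have h2 : x.2 = Finsupp.single f j := by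
        rw [h1] at hx
        exact add_left_cancel hx
      exact absurd (Prod.ext h1 h2) hne
    · rw [notMem_support_iff.mp hxs, zero_mul]
  · rw [Finset.mem_antidiagonal] at h
    exact absurd rfl h

/-- **The pure powers `x_f^j` keep their coefficients** under `x_f ↦ x_f + φ(u)` (`φ(0) = 0`, `φ`
free of `x_f`): in particular the coefficient `c` of `x_f^d`. [folklore] -/
theorem coeff_single_frameChange (τ : MvPolynomial (Fin 4) K →ₐ[K] MvPolynomial (Fin 4) K) (f : Fin 4)
    (φ : MvPolynomial (Fin 4) K) (hf : τ (X f) = X f + φ) (hi : ∀ i, i ≠ f → τ (X i) = X i)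
    (hφ : ∀ a ∈ φ.support, a f = 0 ∧ 1 ≤ a.degree) (H : MvPolynomial (Fin 4) K) (j : ℕ) :
    coeff (Finsupp.single f j) (τ H) = coeff (Finsupp.single f j) H := by
  obtain ⟨R, hR⟩ := exists_taylor_two τ f φ hf hi H
  have h0 : ∀ P : MvPolynomial (Fin 4) K, coeff (Finsupp.single f j) (φ * P) = 0 := fun P => by
    rw [← zero_add (Finsupp.single f j)]
    exact coeff_add_single_mul_eq_zero hφ P (by rw [map_zero]; exact Nat.one_pos) j
  rw [hR, coeff_add, coeff_add, h0, pow_two, mul_assoc, h0, add_zero, add_zero]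

/-- The coefficient of `Σ_{m ∈ S} r_m u^m` at `a`. [folklore] -/
theorem coeff_sum_monomial (S : Finset (Fin 4 →₀ ℕ)) (r : (Fin 4 →₀ ℕ) → K) (a : Fin 4 →₀ ℕ) :
    coeff a (∑ m ∈ S, monomial m (r m)) = if a ∈ S then r a else 0 := by
  classical
  simp only [coeff_sum, coeff_monomial, Finset.sum_ite_eq']

/-- The identity `Σ_i a_i = |a|` in `Finsupp.sum` form. [folklore] -/
theorem sum_self_eq_degree (a : Fin 4 →₀ ℕ) : (a.sum fun _ x => x) = a.degree := rfl

/-- The monomials supported off `f` of degree `n`: membership in `(univ.erase f).finsuppAntidiag n`.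
[folklore] -/
theorem mem_finsuppAntidiag_erase_iff (f : Fin 4) (n : ℕ) (a : Fin 4 →₀ ℕ) :
    a ∈ (Finset.univ.erase f).finsuppAntidiag n ↔ a f = 0 ∧ a.degree = n := by
  rw [Finset.mem_finsuppAntidiag', sum_self_eq_degree]
  constructor
  · rintro ⟨hsum, hsupp⟩
    refine ⟨?_, hsum⟩
    by_contra h
    have := hsupp (Finsupp.mem_support_iff.mpr h)
    simp at this
  · rintro ⟨haf, hdeg⟩
    refine ⟨hdeg, fun i hi => ?_⟩
    rw [Finset.mem_erase]
    exact ⟨fun h => (Finsupp.mem_support_iff.mp hi) (h ▸ haf), Finset.mem_univ _⟩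

/-- `((d - 1 : ℕ) : K) + 1 = d` for `1 ≤ d`. [folklore] -/
theorem cast_pred_add_one {d : ℕ} (hd : 1 ≤ d) : ((d - 1 : ℕ) : K) + 1 = d := by
  rw [← Nat.cast_add_one, Nat.sub_add_cancel hd]

/-! ## 3. One step of the degree-by-degree solve -/

/-- **The inductive step of the Tschirnhaus solve.**  Let `c = coeff_{x_f^d} G ≠ 0`, `d` a unit, and
let `φ` (`x_f`-free, `φ(0) = 0`) kill the `x_f^{d-1}·u^m`-coefficients of `G(x_f + φ, u)` for
`|m| ≤ N`.  Then the degree-`(N+1)` correction `δ := −(d c)⁻¹ Σ_{|m|=N+1} coeff_{x_f^{d-1}u^m}(G(x_f+φ,u))·u^m`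
kills them for `|m| ≤ N + 1` (second-order Taylor: the new error is `δ·∂_f + O(δ²)`, and
`∂_f` contributes `d·c·δ` at `u`-degree `N + 1`).
[cite: Abhyankar1990, Lecture 22 p.174 and p.186 (the SDT computed up to a given order)] [folklore] -/
theorem jet_step {f : Fin 4} {d : ℕ} (hd : 1 ≤ d) (hdK : (d : K) ≠ 0) {G : MvPolynomial (Fin 4) K}
    (hc : coeff (Finsupp.single f d) G ≠ 0) {φ : MvPolynomial (Fin 4) K}
    (hφ : ∀ a ∈ φ.support, a f = 0 ∧ 1 ≤ a.degree)
    (τ : MvPolynomial (Fin 4) K →ₐ[K] MvPolynomial (Fin 4) K) (hτf : τ (X f) = X f + φ)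
    (hτ : ∀ i, i ≠ f → τ (X i) = X i) {N : ℕ}
    (hN : ∀ m : Fin 4 →₀ ℕ, m f = 0 → m.degree ≤ N →
      coeff (m + Finsupp.single f (d - 1)) (τ G) = 0) :
    ∃ δ : MvPolynomial (Fin 4) K,
      (∀ a ∈ δ.support, a f = 0 ∧ a.degree = N + 1) ∧
      (∀ m : Fin 4 →₀ ℕ, m f = 0 → m.degree = N + 1 →
        coeff m δ = -coeff (m + Finsupp.single f (d - 1)) (τ G) /
          (d * coeff (Finsupp.single f d) G)) ∧
      ∀ τ' : MvPolynomial (Fin 4) K →ₐ[K] MvPolynomial (Fin 4) K, τ' (X f) = X f + (φ + δ) →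
        (∀ i, i ≠ f → τ' (X i) = X i) →
        ∀ m : Fin 4 →₀ ℕ, m f = 0 → m.degree ≤ N + 1 →
          coeff (m + Finsupp.single f (d - 1)) (τ' G) = 0 := by
  classical
  -- the correction
  obtain ⟨δ, hδ⟩ : ∃ δ : MvPolynomial (Fin 4) K,
      δ = ∑ m ∈ (Finset.univ.erase f).finsuppAntidiag (N + 1),
        monomial m (-coeff (m + Finsupp.single f (d - 1)) (τ G) /
          (d * coeff (Finsupp.single f d) G)) := ⟨_, rfl⟩
  have hcoeffδ : ∀ a : Fin 4 →₀ ℕ, coeff a δ =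
      if a ∈ (Finset.univ.erase f).finsuppAntidiag (N + 1) then
        -coeff (a + Finsupp.single f (d - 1)) (τ G) / (d * coeff (Finsupp.single f d) G) else 0 :=
    fun a => by rw [hδ]; exact coeff_sum_monomial _ _ a
  have hδsupp : ∀ a ∈ δ.support, a f = 0 ∧ a.degree = N + 1 := by
    intro a ha
    rw [mem_support_iff, hcoeffδ] at ha
    by_cases haS : a ∈ (Finset.univ.erase f).finsuppAntidiag (N + 1)
    · exact (mem_finsuppAntidiag_erase_iff f _ a).mp haS
    · exact absurd (if_neg haS) ha
  have hδsupp' : ∀ a ∈ δ.support, a f = 0 ∧ N + 1 ≤ a.degree := fun a ha =>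
    ⟨(hδsupp a ha).1, (hδsupp a ha).2.ge⟩
  have hδcoeff : ∀ m : Fin 4 →₀ ℕ, m f = 0 → m.degree = N + 1 →
      coeff m δ = -coeff (m + Finsupp.single f (d - 1)) (τ G) /
        (d * coeff (Finsupp.single f d) G) := by
    intro m hmf hdeg
    rw [hcoeffδ, if_pos ((mem_finsuppAntidiag_erase_iff f _ m).mpr ⟨hmf, hdeg⟩)]
  refine ⟨δ, hδsupp, hδcoeff, ?_⟩
  intro τ' hτ'f hτ' m hmf hmdeg
  -- the concrete move by `δ`, and `τ' = τ_δ ∘ τ`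
  let τδ : MvPolynomial (Fin 4) K →ₐ[K] MvPolynomial (Fin 4) K :=
    aeval fun i => if i = f then X f + δ else X i
  have hτδf : τδ (X f) = X f + δ := by simp [τδ]
  have hτδi : ∀ i, i ≠ f → τδ (X i) = X i := fun i hi => by simp [τδ, hi]
  have hτδφ : τδ φ = φ := by
    have h := MvPolynomial.hom_congr_vars
      (f₁ := (τδ : MvPolynomial (Fin 4) K →+* MvPolynomial (Fin 4) K))
      (f₂ := RingHom.id _) (p₁ := φ) (p₂ := φ) (by ext a; simp [τδ]) (fun i hi _ => by
        have hif : i ≠ f := by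
          intro hif
          obtain ⟨a, ha, hia⟩ := (MvPolynomial.mem_vars_iff_mem_support i).mp hi
          exact (Finsupp.mem_support_iff.mp hia) (by rw [hif]; exact (hφ a ha).1)
        rw [RingHom.coe_coe, hτδi i hif, RingHom.id_apply]) rfl
    simpa using h
  have hcomp : τ' = τδ.comp τ := by
    refine MvPolynomial.algHom_ext fun i => ?_
    by_cases hi : i = f
    · rw [hi, hτ'f, AlgHom.comp_apply, hτf, map_add, hτδf, hτδφ]
      ring
    · rw [hτ' i hi, AlgHom.comp_apply, hτ i hi, hτδi i hi]
  obtain ⟨R, hR⟩ := exists_taylor_two τδ f δ hτδf hτδi (τ G)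
  rw [hcomp, AlgHom.comp_apply, hR, coeff_add, coeff_add]
  rcases Nat.lt_or_ge m.degree (N + 1) with hlt | hge
  · -- `|m| ≤ N`: all three terms vanish
    rw [hN m hmf (Nat.lt_succ_iff.mp hlt), coeff_add_single_mul_eq_zero hδsupp' _ hlt,
      pow_two, mul_assoc, coeff_add_single_mul_eq_zero hδsupp' _ hlt, add_zero, add_zero]
  · -- `|m| = N + 1`: the correction cancels the old coefficient
    have hdeg : m.degree = N + 1 := le_antisymm hmdeg hge
    have h3 : coeff (Finsupp.single f (d - 1)) (δ * R) = 0 := by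
      rw [← zero_add (Finsupp.single f (d - 1))]
      exact coeff_add_single_mul_eq_zero hδsupp' R (by rw [map_zero]; exact Nat.succ_pos N) _
    rw [coeff_add_single_mul_of_degree_le hδsupp' _ hmdeg, coeff_pderiv, ← Finsupp.single_add,
      Nat.sub_add_cancel hd, coeff_single_frameChange τ f φ hτf hτ hφ G d, Finsupp.single_eq_same,
      cast_pred_add_one hd, pow_two, mul_assoc, coeff_add_single_mul_of_degree_le hδsupp' _ hmdeg,
      h3, mul_zero, add_zero, hδcoeff m hmf hdeg]
    have hdc : (d : K) * coeff (Finsupp.single f d) G ≠ 0 := mul_ne_zero hdK hc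
    field_simp
    ring

end FrameChange

end Summit.ResolutionOfSingularities.ResolutionOfSingularities.Theorems.PIDim4

end
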